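import Summits.AtomisticToContinuum.Crystallization.Theorems.ExcessDecayLiouvilleGlobalGradientBound

/-!
# Route `ExcessDecayLiouville`: the auxiliary gradient bound for the global gradient (nonlinear half, XXXI)

Harmonic-replacement architecture for item `ExcessDecay` (stmt-AtomisticToContinuum-9334), nonlinear half.
`aux_gradient` supplies the bound `G` of `NN[ũ, c, 13r/16]` used by `global_gradient`: `step_gradient` at the
auxiliary cut-off `χ′` (`= 1` on the sites of `B_{7r/8}(c)`) with radii `(13r/16, 27r/32)` about `c` and crude (value)
currencies; the forcing sum on `B_{27r/32}(c)` is `aux_forcing_sum` (`step_forcing_gen` with depth `r/32`).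
All `[folklore]`; helper lemmas, nothing here closes an item.
-/

noncomputable section

namespace Summit.AtomisticToContinuum.Crystallization.Theorems.ExcessDecayLiouville

open scoped BigOperators Topology InnerProductSpace RealInnerProductSpace Classical
open Literature.MathematicalPhysics.StatisticalMechanics
open Summit.AtomisticToContinuum.Crystallization.Theorems.PhononStabilityNegative

-- Local notation: the force-constant map `K(e)w = h(|e|²)w + 2⟪e,w⟫h′(|e|²)e`.
local notation3 "𝕂[" e "] " w:max =>
  (-((‖e‖ ^ 2)⁻¹) ^ 7 + ((‖e‖ ^ 2)⁻¹) ^ 4) • w + (2 * ⟪e, w⟫ * (7 * ((‖e‖ ^ 2)⁻¹) ^ 8 - 4 * ((‖e‖ ^ 2)⁻¹) ^ 5)) • e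
-- Local notation: the pair force `F(x) = h(|x|²) x`.
local notation3 "𝐅[" x "]" => ((-((‖x‖ ^ 2)⁻¹) ^ 7 + ((‖x‖ ^ 2)⁻¹) ^ 4) • x)
set_option quotPrecheck false in
-- Local notation: ball indicator.
local notation "𝟙ᵇ[" x ", " c ", " R "]" => (if dist (x : EuclideanSpace ℝ (Fin 3)) c ≤ R then (1 : ℝ) else 0)

section

variable {X : Set (EuclideanSpace ℝ (Fin 3))} {c : EuclideanSpace ℝ (Fin 3)} {r ε δ κ : ℝ}
  {t : Fin 2 → EuclideanSpace ℝ (Fin 3)} {A : EuclideanSpace ℝ (Fin 3) →L[ℝ] EuclideanSpace ℝ (Fin 3)}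
  {π : EuclideanSpace ℝ (Fin 3) → EuclideanSpace ℝ (Fin 3)}
  {aff : (EuclideanSpace ℝ (Fin 3)) → (EuclideanSpace ℝ (Fin 3))} {a : Fin 2 → EuclideanSpace ℝ (Fin 3)}
  {B : (EuclideanSpace ℝ (Fin 3)) →L[ℝ] (EuclideanSpace ℝ (Fin 3))} {x₀ : EuclideanSpace ℝ (Fin 3)}

variable (hA : Adm₀ A) (hI : Inner₀ t A)

set_option quotPrecheck false in
-- Local notation: the operator row `(L v)(p)`.
local notation "𝕃" v:max " @ " p:max =>
  tsum (fun q : Sites₀ t A => (if ((p : Sites₀ t A) : EuclideanSpace ℝ (Fin 3)) ≠ q then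
    𝕂[((p : Sites₀ t A) : EuclideanSpace ℝ (Fin 3)) - q] (v ((p : Sites₀ t A) : EuclideanSpace ℝ (Fin 3)) - v q) else 0))
set_option quotPrecheck false in
-- Local notation: the finite near-neighbour form on the ball of radius `X` about the centre `cc`.
local notation "NN[" v ", " cc ", " X "]" =>
  (∑ p ∈ (finite_sites_dist_le (t := t) (A := A) hA hI cc X).toFinset,
    ∑ q ∈ (finite_sites_dist_le (t := t) (A := A) hA hI cc X).toFinset,
      (if p ≠ q ∧ dist p q ≤ 11 / 10 then ‖v p - v q‖ ^ 2 else (0 : ℝ)))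

include hA hI in
/-- **The forcing sum on `B_{27r/32}(c)`** for the auxiliary cut-off (`step_forcing_gen` with depth `r/32`).
[folklore] -/
theorem aux_forcing_sum (hX : X.Finite) (hsep : Sep₀ X δ) (hδ : 0 < δ) (hδ1 : δ ≤ 1)
    (hε0 : 0 ≤ ε) (hε : 2 * ε < δ) (hr : 64 ≤ r)
    (hXb : ∀ p ∈ X, dist p c ≤ r → ∃ m : Fin 2, ∃ z ∈ Λ₀, dist p (t m + A z) ≤ ε)
    (hπ : ∀ s' ∈ Sites₀ t A, dist s' c ≤ r → π s' ∈ X ∧ dist (π s') s' ≤ ε)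
    (SR : Finset (EuclideanSpace ℝ (Fin 3))) (hSR : ∀ x, x ∈ SR ↔ x ∈ Sites₀ t A ∧ dist x c ≤ r)
    (χ' : EuclideanSpace ℝ (Fin 3) → ℝ) (hχ'1abs : ∀ x, |1 - χ' x| ≤ 1) (hχ'one : ∀ q ∈ SR, dist q c ≤ 7 * r / 8 → χ' q = 1)
    (haff : ∀ (m : Fin 2) (z : EuclideanSpace ℝ (Fin 3)), z ∈ Λ₀ → aff (t m + A z) = a m + B (t m + A z - x₀))
    (ha : ‖a 0 - a 1‖ ≤ 1 / 50) (hB : ‖B‖ ≤ 1 / 50)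
    (hrelax : ∀ s : Sites₀ t A, (∑' q : Sites₀ t A, (if (s : EuclideanSpace ℝ (Fin 3)) ≠ q then
        𝐅[((s : EuclideanSpace ℝ (Fin 3)) - q) + (aff s - aff q)] else 0)) = 0)
    (f' : (EuclideanSpace ℝ (Fin 3)) → (EuclideanSpace ℝ (Fin 3)))
    {Du : ℝ} (hDu0 : 0 ≤ Du) (hDu : ∀ x ∈ SR, ‖(π x - x) - aff x‖ ≤ Du) (hf'D : ∀ x ∈ Sites₀ t A, ‖f' x‖ ≤ Du) :
    ∑ x ∈ SR.filter (fun p => dist p c ≤ 27 * r / 32),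
      ‖(fun s : EuclideanSpace ℝ (Fin 3) =>
        (-(∑ s' ∈ SR.erase s, 𝐅[(s - s') + (aff s - aff s')]) -
          (∑ q ∈ (hX.toFinset.erase (π s)) \ ((SR.erase s).image π),
            (deriv lennardJones (dist (π s) q) / dist (π s) q) • (π s - q)) +
          ((∑ s' ∈ SR.erase s, 𝕂[s - s'] ((1 - χ' s') • ((π s' - s') - aff s'))) +
            ∑' q : ↑((SR.subtype (· ∈ Sites₀ t A) : Set (Sites₀ t A)))ᶜ,
              (if s ≠ (q : EuclideanSpace ℝ (Fin 3)) then 𝕂[s - (q : EuclideanSpace ℝ (Fin 3))] ((π s - s) - aff s) else 0)))) x‖ * ‖f' x‖ ≤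
      (31488 * (1024 / ((23 / 25 : ℝ) ^ 3 * (r - 27 * r / 32) ^ 4)) + 2048 / (δ ^ 3 * (r - 27 * r / 32 - 2 * ε) ^ 4) +
          (38 * Du * (1024 / ((23 / 25 : ℝ) ^ 3 * (r / 32) ^ 5)) + 38 * Du * (1024 / ((23 / 25 : ℝ) ^ 3 * (r - 27 * r / 32) ^ 5)))) *
        Du * (32 * (27 * r / 32) ^ 3) := by
  have hSRS : ∀ x ∈ SR, x ∈ Sites₀ t A := fun x hx => ((hSR x).1 hx).1
  have hb1 : (1 : ℝ) ≤ 27 * r / 32 := by linarith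
  have hforce := fun (p : Sites₀ t A) (hp : (p : EuclideanSpace ℝ (Fin 3)) ∈ SR) (hpc : dist (p : EuclideanSpace ℝ (Fin 3)) c ≤ 27 * r / 32) =>
    step_forcing_gen hA hI hX hsep hδ hε0 hε hXb hπ haff ha hB hrelax SR hSR χ' hχ'1abs
      (Rone := 7 * r / 8) (dmax := 27 * r / 32) (ϱ₁ := r / 32) hχ'one (by linarith) (by linarith) (by linarith) (by linarith)
      hDu0 hDu p hp hpc
  have hΦ0 : 0 ≤ (31488 * (1024 / ((23 / 25 : ℝ) ^ 3 * (r - 27 * r / 32) ^ 4)) + 2048 / (δ ^ 3 * (r - 27 * r / 32 - 2 * ε) ^ 4) +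
      (38 * Du * (1024 / ((23 / 25 : ℝ) ^ 3 * (r / 32) ^ 5)) + 38 * Du * (1024 / ((23 / 25 : ℝ) ^ 3 * (r - 27 * r / 32) ^ 5)))) := by
    have h1 : 0 < r - 27 * r / 32 := by linarith
    have h2 : 0 < r - 27 * r / 32 - 2 * ε := by linarith
    positivity
  have hmem : ∀ x ∈ SR.filter (fun p => dist p c ≤ 27 * r / 32), x ∈ Sites₀ t A ∧ dist x c ≤ 27 * r / 32 := fun x hx => by
    rw [Finset.mem_filter] at hx; exact ⟨hSRS x hx.1, hx.2⟩
  calc _ ≤ ∑ x ∈ SR.filter (fun p => dist p c ≤ 27 * r / 32),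
        (31488 * (1024 / ((23 / 25 : ℝ) ^ 3 * (r - 27 * r / 32) ^ 4)) + 2048 / (δ ^ 3 * (r - 27 * r / 32 - 2 * ε) ^ 4) +
          (38 * Du * (1024 / ((23 / 25 : ℝ) ^ 3 * (r / 32) ^ 5)) + 38 * Du * (1024 / ((23 / 25 : ℝ) ^ 3 * (r - 27 * r / 32) ^ 5)))) * Du := by
        refine Finset.sum_le_sum fun x hx => ?_
        obtain ⟨hxS, hxd⟩ := hmem x hx
        exact mul_le_mul (hforce ⟨x, hxS⟩ (Finset.mem_filter.1 hx).1 hxd) (hf'D x hxS) (norm_nonneg _) hΦ0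
    _ = (SR.filter (fun p => dist p c ≤ 27 * r / 32)).card * ((31488 * (1024 / ((23 / 25 : ℝ) ^ 3 * (r - 27 * r / 32) ^ 4)) +
          2048 / (δ ^ 3 * (r - 27 * r / 32 - 2 * ε) ^ 4) +
          (38 * Du * (1024 / ((23 / 25 : ℝ) ^ 3 * (r / 32) ^ 5)) + 38 * Du * (1024 / ((23 / 25 : ℝ) ^ 3 * (r - 27 * r / 32) ^ 5)))) * Du) := by
        rw [Finset.sum_const, nsmul_eq_mul]
    _ ≤ (32 * (27 * r / 32) ^ 3) * _ := mul_le_mul_of_nonneg_right (card_ball_sites_le hA hI c hb1 _ hmem) (mul_nonneg hΦ0 hDu0)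
    _ = _ := by ring

include hA hI in
/-- **The auxiliary gradient bound**: with a cut-off `χ′` (`= 1` on the sites of `B_{7r/8}(c)`, `0` off `SR`,
`|χ′| ≤ 1`, `|1 − χ′| ≤ 1`), `step_gradient` at `(13r/16, 27r/32)` about `c` with crude currencies bounds
`NN[ũ, c, 13r/16]`. [folklore] -/
theorem aux_gradient (hκ0 : 0 < κ)
    (hκ : ∀ v : (EuclideanSpace ℝ (Fin 3)) → (EuclideanSpace ℝ (Fin 3)), (Function.support v).Finite →
      Function.support v ⊆ Sites₀ t A → κ * nnForm t A v ≤ ∑' p : Sites₀ t A, ⟪𝕃 v @ p, v p⟫)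
    (hX : X.Finite) (hsep : Sep₀ X δ) (hequil : Equil₀ X) (hδ : 0 < δ) (hδ1 : δ ≤ 1)
    (hε0 : 0 ≤ ε) (hε : 2 * ε < δ) (hr : 64 ≤ r)
    (hXb : ∀ p ∈ X, dist p c ≤ r → ∃ m : Fin 2, ∃ z ∈ Λ₀, dist p (t m + A z) ≤ ε)
    (hπ : ∀ s' ∈ Sites₀ t A, dist s' c ≤ r → π s' ∈ X ∧ dist (π s') s' ≤ ε)
    (hinj : ∀ s₁ ∈ Sites₀ t A, ∀ s₂ ∈ Sites₀ t A, dist s₁ c ≤ r → dist s₂ c ≤ r → π s₁ = π s₂ → s₁ = s₂)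
    (SR : Finset (EuclideanSpace ℝ (Fin 3))) (hSR : ∀ x, x ∈ SR ↔ x ∈ Sites₀ t A ∧ dist x c ≤ r)
    (χ' : EuclideanSpace ℝ (Fin 3) → ℝ) (hχ'0 : ∀ q ∈ Sites₀ t A, q ∉ SR → χ' q = 0) (hχ'S : ∀ x, x ∉ Sites₀ t A → χ' x = 0)
    (hχ'abs : ∀ x, |χ' x| ≤ 1) (hχ'1abs : ∀ x, |1 - χ' x| ≤ 1) (hχ'one : ∀ q ∈ SR, dist q c ≤ 7 * r / 8 → χ' q = 1)
    (haff : ∀ (m : Fin 2) (z : EuclideanSpace ℝ (Fin 3)), z ∈ Λ₀ → aff (t m + A z) = a m + B (t m + A z - x₀))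
    (hrelax : ∀ s : Sites₀ t A, (∑' q : Sites₀ t A, (if (s : EuclideanSpace ℝ (Fin 3)) ≠ q then
        𝐅[((s : EuclideanSpace ℝ (Fin 3)) - q) + (aff s - aff q)] else 0)) = 0)
    (ha : ‖a 0 - a 1‖ ≤ 1 / 100) (hBr : 2 * r * ‖B‖ ≤ 1 / 100)
    (ut f' : (EuclideanSpace ℝ (Fin 3)) → (EuclideanSpace ℝ (Fin 3)))
    (hudef : ut = fun x => (π x - x) - aff x) (hf'def : f' = fun x => χ' x • ((π x - x) - aff x))
    (hf'fin : (Function.support f').Finite)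
    {Du : ℝ} (hDu0 : 0 ≤ Du) (hDu1 : Du ≤ 1 / 20) (hDu : ∀ x ∈ SR, ‖ut x‖ ≤ Du)
    (hΛκ : 4000000 * (210000 * ((25 / 23) * (2 * Du + ‖a 0 - a 1‖) + ‖B‖)) ≤ κ / 12) :
    NN[ut, c, 13 * r / 16] ≤
      2 ^ (5 + 1) *
        (((2 / κ * (19 * 16 * (1024 / ((23 / 25 : ℝ) ^ 3 * (23 / 25 : ℝ) ^ 3))) +
            16 * (11 / 10 : ℝ) ^ 8 * (1024 / ((23 / 25 : ℝ) ^ 3 * (23 / 25 : ℝ) ^ 3))) *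
            (32 * (2 * (27 * r / 32)) ^ 3 * Du ^ 2) * (27 * r / 32 - 13 * r / 16) ^ 3 +
          2 / κ * (38 * 4 ^ 5 * (1024 / (23 / 25 : ℝ) ^ 3) * (32 * (2 * (27 * r / 32)) ^ 3 * Du ^ 2) +
            (210000 * ((25 / 23) * (2 * Du + ‖a 0 - a 1‖) + ‖B‖)) * 20 ^ 5 * ((7 / 2) * (1024 / (23 / 25 : ℝ) ^ 3) *
              (32 * (27 * r / 32) ^ 3 * Du ^ 2) + ((1024 / (23 / 25 : ℝ) ^ 3) * (32 * r ^ 3 * Du ^ 2)) / 2)) +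
          120 ^ 5 * (160 * (32 * (27 * r / 32) ^ 3 * Du ^ 2))) / (27 * r / 32 - 13 * r / 16) ^ 5) +
      2 * (2 / κ * ((31488 * (1024 / ((23 / 25 : ℝ) ^ 3 * (r - 27 * r / 32) ^ 4)) + 2048 / (δ ^ 3 * (r - 27 * r / 32 - 2 * ε) ^ 4) +
          (38 * Du * (1024 / ((23 / 25 : ℝ) ^ 3 * (r / 32) ^ 5)) + 38 * Du * (1024 / ((23 / 25 : ℝ) ^ 3 * (r - 27 * r / 32) ^ 5)))) *
            Du * (32 * (27 * r / 32) ^ 3) +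
          (210000 * ((25 / 23) * (2 * Du + ‖a 0 - a 1‖) + ‖B‖)) * (8192 * (27 * r / 32) ^ 3 * 0) / 2 +
          19 * 8192 * (27 * r / 32) ^ 3 * ((13 * r / 16)⁻¹ ^ 8 * (32 * r ^ 3 * Du ^ 2)))) := by
  have hSRS : ∀ x ∈ SR, x ∈ Sites₀ t A := fun x hx => ((hSR x).1 hx).1
  have hr0 : 0 < r := by linarith
  have hBn : 0 ≤ ‖B‖ := norm_nonneg _
  have hB50 : ‖B‖ ≤ 1 / 50 := by nlinarith
  have hsmall : ‖a 0 - a 1‖ + 2 * r * ‖B‖ ≤ 1 / 50 := by linarith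
  have hDu' : ∀ x ∈ SR, ‖(π x - x) - aff x‖ ≤ Du := fun x hx => by have := hDu x hx; rw [hudef] at this; exact this
  have hf'fin' : (Function.support (fun x => χ' x • ((π x - x) - aff x))).Finite := by rw [hf'def] at hf'fin; exact hf'fin
  -- the raw auxiliary gradient bound, folded
  have hraw := step_gradient hA hI hκ0 hκ hX hequil hπ hinj SR hSR χ' hχ'0 hχ'S hχ'abs (by linarith : 7 * r / 8 ≤ r) hχ'one haff
    (D₀ := 2 * Du) (by linarith) (by linarith) hsmall (fun x hx => by linarith [hDu' x hx]) hΛκ hf'fin'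
    (c₀ := c) (a₁ := 13 * r / 16) (b₁ := 27 * r / 32) (by linarith) (by linarith) (by rw [dist_self]; linarith)
  rw [← hf'def, ← hudef] at hraw
  -- ũ = f' on B_{13r/16}(c)
  have hcongr : NN[ut, c, 13 * r / 16] = NN[f', c, 13 * r / 16] := by
    refine NN_congr hA hI fun x hx hxd => ?_
    rw [hf'def, hudef]; simp only []
    by_cases hxSR : x ∈ SR
    · rw [hχ'one x hxSR (by linarith), one_smul]
    · exfalso; exact hxSR ((hSR x).2 ⟨hx, by linarith⟩)
  rw [hcongr]
  refine hraw.trans ?_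
  -- the crude currencies
  have hf'D : ∀ x ∈ Sites₀ t A, ‖f' x‖ ≤ Du := by
    intro x hx
    rw [hf'def]; simp only [norm_smul, Real.norm_eq_abs]
    by_cases hxSR : x ∈ SR
    · calc _ ≤ 1 * Du := mul_le_mul (hχ'abs x) (hDu' x hxSR) (norm_nonneg _) zero_le_one
        _ = Du := one_mul _
    · rw [hχ'0 x hx hxSR, abs_zero, zero_mul]; exact hDu0
  have hf'zero : ∀ x ∈ Sites₀ t A, r < dist x c → f' x = 0 := by
    intro x hx hxd
    rw [hf'def]; simp only []
    rw [hχ'0 x hx (fun h => by linarith [((hSR x).1 h).2]), zero_smul]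
  have hb1 : (1 : ℝ) ≤ 27 * r / 32 := by linarith
  have hM2b : (∑' p : Sites₀ t A, ‖f' p‖ ^ 2 * 𝟙ᵇ[p, c, 2 * (27 * r / 32)]) ≤ 32 * (2 * (27 * r / 32)) ^ 3 * Du ^ 2 :=
    mass_le_of_pointwise hA hI _ (by linarith) fun x hx _ => hf'D x hx
  have hMb : (∑' p : Sites₀ t A, ‖f' p‖ ^ 2 * 𝟙ᵇ[p, c, 27 * r / 32]) ≤ 32 * (27 * r / 32) ^ 3 * Du ^ 2 :=
    mass_le_of_pointwise hA hI _ hb1 fun x hx _ => hf'D x hx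
  have hMr : (∑' p : Sites₀ t A, ‖f' p‖ ^ 2 * 𝟙ᵇ[p, c, r]) ≤ 32 * r ^ 3 * Du ^ 2 :=
    mass_le_of_pointwise hA hI _ (by linarith) fun x hx _ => hf'D x hx
  have hESR : ∑ x ∈ SR.filter (fun p => dist p c ≤ 27 * r / 32), ‖f' x‖ ^ 2 ≤ 32 * (27 * r / 32) ^ 3 * Du ^ 2 :=
    (sum_filter_le_mass hA hI _ SR hSRS _).trans hMb
  have hcardSR : (SR.card : ℝ) ≤ 32 * r ^ 3 := card_ball_sites_le hA hI c (by linarith) _ fun q hq => (hSR q).1 hq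
  have hΘ0 : ∑ q ∈ SR.filter (fun q => dist q c ≤ 2 * (27 * r / 32)), ‖ut q‖ ^ 2 ≤ 32 * r ^ 3 * Du ^ 2 := by
    calc _ ≤ ∑ q ∈ SR, ‖ut q‖ ^ 2 := Finset.sum_le_sum_of_subset_of_nonneg (Finset.filter_subset _ _) fun _ _ _ => by positivity
      _ ≤ ∑ q ∈ SR, Du ^ 2 := Finset.sum_le_sum fun q hq => pow_le_pow_left₀ (norm_nonneg _) (hDu q hq) 2
      _ = SR.card * Du ^ 2 := by rw [Finset.sum_const, nsmul_eq_mul]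
      _ ≤ 32 * r ^ 3 * Du ^ 2 := mul_le_mul_of_nonneg_right hcardSR (sq_nonneg _)
  have hΘ1 : ∑ q ∈ SR.filter (fun q => ¬ dist q c ≤ 2 * (27 * r / 32)), (dist q c)⁻¹ ^ 8 * ‖ut q‖ ^ 2 = 0 := by
    refine Finset.sum_eq_zero fun q hq => ?_
    rw [Finset.mem_filter] at hq
    exact absurd (((hSR q).1 hq.1).2.trans (by linarith)) hq.2
  have hN : NN[f', c, 27 * r / 32] ≤ 160 * (32 * (27 * r / 32) ^ 3 * Du ^ 2) :=
    (NN_le_mass hA hI _ _).trans (mul_le_mul_of_nonneg_left hMb (by norm_num))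
  -- the forcing on B_{27r/32}(c)
  have hPb := aux_forcing_sum hA hI hX hsep hδ hδ1 hε0 hε hr hXb hπ SR hSR χ' hχ'1abs hχ'one haff (by linarith) hB50 hrelax f' hDu0 hDu' hf'D
  have hJ : (∑' q : Sites₀ t A, ‖f' q‖ ^ 2 * (max (dist (q : EuclideanSpace ℝ (Fin 3)) c) (13 * r / 16))⁻¹ ^ 8) ≤
      (13 * r / 16)⁻¹ ^ 8 * (32 * r ^ 3 * Du ^ 2) := by
    refine (farMass_le_inv_mul_mass (t := t) (A := A) f' hf'fin c c (by linarith : (0 : ℝ) < 13 * r / 16) hf'zero).trans ?_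
    exact mul_le_mul_of_nonneg_left hMr (by positivity)
  -- assemble
  rw [hΘ1] at hraw
  rw [mul_zero] at hraw ⊢
  have hΛ0 : 0 ≤ 210000 * ((25 / 23) * (2 * Du + ‖a 0 - a 1‖) + ‖B‖) :=
    mul_nonneg (by norm_num) (add_nonneg (mul_nonneg (by norm_num) (by linarith [norm_nonneg (a 0 - a 1)])) hBn)
  have hden : 0 < 27 * r / 32 - 13 * r / 16 := by linarith
  clear hcongr
  gcongr
  rw [hΘ1, mul_zero]

end

end Summit.AtomisticToContinuum.Crystallization.Theorems.ExcessDecayLiouville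

end
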